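import Literature.NumberTheory.Rogawski1990.UnitFundamentalLemmaExplicitSplit
import Literature.NumberTheory.Rogawski1990.UnitFundamentalLemmaExplicitNonsplitClosedProof
import HarnessLib

/-!
# [Rogawski1990, §4.9 Prop. 4.9.1 (b)] the unit fundamental lemma for `(U(3), U(2) × U(1))`, CLOSED form — DISCHARGED:
# `unitFundamentalLemmaExplicitClosed_holds`

Kernel-lane companion of ★ `Literature/NumberTheory/Rogawski1990/LocalTransferUnitExplicitFactor.lean`: its CLOSED named fact
★ `UnitFundamentalLemmaExplicitClosed` («N7», books row #103 of the cell hodgecm-mathlib) is PROVED here, on the Literature side, by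
composing two tree theorems:

* ★ `unitFundamentalLemmaExplicitNonsplitClosed_holds : UnitFundamentalLemmaExplicitNonsplitClosed`
  (`UnitFundamentalLemmaExplicitNonsplitClosedProof.lean`: the inert half, Flicker's elementary proof of [BlasiusRogawski1992]), and
* ★ `unitFundamentalLemmaExplicitClosed_of_nonsplitClosed : UnitFundamentalLemmaExplicitNonsplitClosed → UnitFundamentalLemmaExplicitClosed`
  (`UnitFundamentalLemmaExplicitSplit.lean` §2: the split half is proved in its §1).

This is the same one-argument term the summit side writes for `stub_N7` (`Summits/HodgeConjecture/…/F0_U3LettersRung1KitRung0.lean`);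
it was missing from `Literature/`, where the fact therefore still counted as unproved.  THEOREMS ONLY (no definition, no named fact,
no `sorry`, no instance, no notation); cell hodgecm-mathlib, seat B-typ01 (g33); net debt −1.

## References
* [Rogawski1990] J. Rogawski, *Automorphic representations of unitary groups in three variables*, Ann. of Math. Stud. 123 (1990),
  §4.9 Prop. 4.9.1 (b) p. 55; §14.6 p. 242.
* [BlasiusRogawski1992] D. Blasius, J. Rogawski, *Fundamental lemmas for `U(3)` and related groups*, in: The zeta functions of Picard
  modular surfaces (1992), Thm. 1.
* [Flicker1998UnitaryFL] Y. Flicker, *Elementary proof of a fundamental lemma for a unitary group*, Canad. J. Math. 50 (1998), Thm. 15,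
  Thm. 18.
-/

namespace Literature.NumberTheory.Rogawski1990

/-- ★ `UnitFundamentalLemmaExplicitClosed` HOLDS ([Rogawski1990, Prop. 4.9.1 (b)], the unit fundamental lemma for `(U(3), U(2) × U(1))` at
every frame: CM field `L`, anisotropic hermitian `H′`, unitary `μ` restricting to `ω_{L/L⁺}`, Borel σ-algebras and Haar measures): the
inert half ★ `unitFundamentalLemmaExplicitNonsplitClosed_holds` fed to the split/non-split junction ★
`unitFundamentalLemmaExplicitClosed_of_nonsplitClosed`. [cite: Rogawski1990, §4.9 Prop. 4.9.1 (b) p. 55; §14.6 p. 242] [cite: BlasiusRogawski1992, Thm. 1] -/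
theorem unitFundamentalLemmaExplicitClosed_holds : UnitFundamentalLemmaExplicitClosed :=
  unitFundamentalLemmaExplicitClosed_of_nonsplitClosed unitFundamentalLemmaExplicitNonsplitClosed_holds

end Literature.NumberTheory.Rogawski1990
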